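import Summits.CriticalPhenomena.PercolationContinuityZ3.Theorems.Transplant.SkelFrmBParamsFaceA
import Summits.CriticalPhenomena.PercolationContinuityZ3.Theorems.Transplant.SkelNegBParamsFaceA
import Summits.CriticalPhenomena.PercolationContinuityZ3.Theorems.Transplant.SkelPhiFaceSlots2
import Summits.CriticalPhenomena.PercolationContinuityZ3.Theorems.Transplant.SkelFrmBParamsSlots
import Summits.CriticalPhenomena.PercolationContinuityZ3.Theorems.Transplant.SkelNegBParamsSlots
import Summits.CriticalPhenomena.PercolationContinuityZ3.Theorems.Transplant.SkelFrm1SlotTypes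
import Summits.CriticalPhenomena.PercolationContinuityZ3.Theorems.Transplant.SkelFrm1ParamsPO
import Summits.CriticalPhenomena.PercolationContinuityZ3.Theorems.Transplant.SkelFrm1ParamsLBL
import Summits.CriticalPhenomena.PercolationContinuityZ3.Theorems.Transplant.SkelFrmBParamsKitA
import Summits.CriticalPhenomena.PercolationContinuityZ3.Theorems.Transplant.SkelFrmBParamsKitS
import Summits.CriticalPhenomena.PercolationContinuityZ3.Theorems.Transplant.SkelFrm1ParamsLF
import Summits.CriticalPhenomena.PercolationContinuityZ3.Theorems.Transplant.SkelFrm1ParamsLO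
import Summits.CriticalPhenomena.PercolationContinuityZ3.Theorems.Transplant.SkelFrmBParamsLF
import Summits.CriticalPhenomena.PercolationContinuityZ3.Theorems.Transplant.SkelFrmBParamsFineSize
import Summits.CriticalPhenomena.PercolationContinuityZ3.Theorems.Transplant.SkelFrmBParamsLFA
import Summits.CriticalPhenomena.PercolationContinuityZ3.Theorems.Transplant.SkelFrmBParamsLO
import Summits.CriticalPhenomena.PercolationContinuityZ3.Theorems.Transplant.SkelFrmBParamsB
import Summits.CriticalPhenomena.PercolationContinuityZ3.Theorems.Transplant.SkelFrmBParamsFineSizeA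
import Summits.CriticalPhenomena.PercolationContinuityZ3.Theorems.Transplant.SkelFrmBParamsSlotsR
import Summits.CriticalPhenomena.PercolationContinuityZ3.Theorems.Transplant.SkelFrmBParamsSlotsRS
import Summits.CriticalPhenomena.PercolationContinuityZ3.Theorems.Transplant.SkelFrmBParamsSched
import Summits.CriticalPhenomena.PercolationContinuityZ3.Theorems.Transplant.SkelFrmBParamsSlotsT
import Summits.CriticalPhenomena.PercolationContinuityZ3.Theorems.Transplant.SkelFrmBParamsReachFC
import Summits.CriticalPhenomena.PercolationContinuityZ3.Theorems.Transplant.SkelFrmBParamsSlotsTA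
import Summits.CriticalPhenomena.PercolationContinuityZ3.Theorems.Transplant.SkelFrmBParamsFaceLat
import Summits.CriticalPhenomena.PercolationContinuityZ3.Theorems.Transplant.SkelFrmBParamsFaceLatA
import Summits.CriticalPhenomena.PercolationContinuityZ3.Theorems.Transplant.SkelFrmBParamsFace
import Summits.CriticalPhenomena.PercolationContinuityZ3.Theorems.Transplant.SkelNegBParamsFaceRoomsA
import Summits.CriticalPhenomena.PercolationContinuityZ3.Theorems.Transplant.PlanarSkeletonFrmDefs
import Summits.CriticalPhenomena.PercolationContinuityZ3.Theorems.Transplant.SkelPhiStepIDataNS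
import HarnessLib

/-!
# N2 (frames-only node `SamePDropOfSkeletonFrm₁`, OPEN) params column over `PlanarSkeletonFrm` — (ζ″) ledger, shape (B′) of record ((R-14)):
# MECHANICAL PORT of N1's `SkelNegBParamsFaceRoomsA` — (ζ′) chain (`A := NegB.Aof κ = 800·Kq`), part FaceRoomsA: THE (F) WRAPPER'S LEVEL / FRAME-ROOM / COUNT / FACE-APRON
# BINDERS SERVED AT THE (ζ′) RECORD — p1-g13's provider file for hp-8 g36's layer (b) `NegB.faceOblRM_negBTB2` (lead g8 05:47:38Z / 06:04:41Z: one writer per file; these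
# are the … (N1 title abridged; see `SkelNegBParamsFaceRoomsA`)
builds on p205010 (kernel theorem, internal audit signed; external expert review pending) — nothing in this file uses p205010; NOTHING is claimed about the
open node `SamePDropOfSkeletonFrm₁` (`SamePDropOfSkeletonNeg₁` is CLOSED in the tree and untouched by this file).
Status sentence (coordinator 2026-08-20T04:30Z): "θ(p_c) = 0 on ℤ^d, all d ≥ 2 — kernel-verified (Lean 4/Mathlib, standard axioms); internal adversarial
audit SIGNED 2026-08-20 04:29Z; external expert review pending."
Lane `prim-bschramm-*`, seat `prim-bschramm-p1` (gen 17; (F) value-layer leaf, lead g11 06:35:07Z) running stmt-g19's port tool of record; helper file (`--supports stmt-CriticalPhenomena-4575 --as helper`); ledger HOME/prim-bschramm-stmt/FRM-PARAMS.md §9, (R-14).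
PORT RULES (HOME/prim-bschramm-stmt-g19/lean/port_frm.py, the tool of record per (R-14)): outer namespace `PlanarSkeletonNeg ↦ PlanarSkeletonFrm`, carrier binder
`(Φ : PlanarSkeletonFrm G)`, record binder `(D : Skelφ.StepI.DataNS V)` (the selectors travel IN the record, `SkelPhiStepIDataNS`); section variables INLINED into every
declaration header; inner namespaces (`Neg`/`NegB`/`KS`/…) and every short name KEPT so all cross-references resolve unchanged; declarations using no section variable are
NOT re-declared (N1's originals are referenced fully qualified). Mathematical content, proofs, docstrings and citations are N1's, verbatim, except where stated next.
NOT PORTED: §Kit (`counts_face_T`, `faceApron_rooms_T`) — apron kit retired under (S0)/(R-35), served by `NegB.KS0` (SkelFrmBChoiceNums). SELECTORS IN THIS FILE ((R-14) condition of record — joint selection, `D.sN`'s first argument is the literal handed to `D.sM`): none (pure port; the pairs are read through their N1 names).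
N1 HEADER (kept for the reader):
helper file (`--supports stmt-CriticalPhenomena-4575 --as helper`).
[cite: KozmaNitzan2024, §4 Lemma 12 (pp. 23–25)] [cite: MartineauTassion2017, §3.2 Lemma 3.5, §4.3 Lemma 4.2]
-/

noncomputable section

open scoped Classical

namespace Summit.CriticalPhenomena.PercolationContinuityZ3.Theorems.Transplant

namespace PlanarSkeletonFrm

namespace NegB

open Literature.Probability.Percolation Literature.Probability.LatticeModels SimpleGraph
open Literature.Probability.Percolation.KozmaNitzan.Cells (oth)
open SkelConc (Consts)
open SkelI (tanOff)
open Skelφ (shellD)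
open Skelφ.StepI (DataN)
open Neg

/-! ## §1 Levels vs cells, the count unit, the frame rooms (at `g := KS.gT mk gx`) -/

section Rooms

/-- `RlevA ≤ RA′` (`RA′ = RlevA + 1`) — the `hRl` of FaceA's `hkF_RA` at `Rl := RlevA`. [folklore] -/
theorem RlevA_le_RA' (κ : Consts) {V : Type} [Countable V] {G : SimpleGraph V} [G.LocallyFinite] (Φ : PlanarSkeletonFrm G) (t : V) (p : unitInterval) (D : Skelφ.StepI.DataNS V) (mk : ℕ) : KS.RlevA κ Φ t p D mk ≤ KS.RA' κ Φ t p D mk := by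
  rw [← (KS.RA'_eq κ Φ t p D mk).2.1]; exact Nat.le_succ _

/-- **Levels vs the (ζ′) cells** at `g := gT`: `RlevA + 4 ≤ 10·s_i` and `RlevA + 4 ≤ 3·r_i` (hp-8's `hRlev/hRlev'`; `s_i ≥ 6RA′+11`, `RA′ = RlevA + 1`,
`r_i = K·s_i`, `K ≥ 40`). [folklore] -/
theorem hRlev_RA (κ : Consts) {V : Type} [DecidableEq V] [Countable V] {G : SimpleGraph V} [G.LocallyFinite] (Φ : PlanarSkeletonFrm G) (t : V) (p : unitInterval) (D : Skelφ.StepI.DataNS V) (f : ℕ) (mk : ℕ) (gx : Neg.FSlot) (hN : EqNumL κ Φ t p D (KS.gT mk gx κ Φ t p D) f) (hκ : (hL κ Φ t p D (KS.gT mk gx κ Φ t p D) f).natAbs ≤ 10 * nL κ Φ t p D (KS.gT mk gx κ Φ t p D) f)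
    (i : Fin 2) :
    KS.RlevA κ Φ t p D mk + 4 ≤ 10 * (fcellsA κ Φ t p D (KS.gT mk gx κ Φ t p D) f).s i ∧ KS.RlevA κ Φ t p D mk + 4 ≤ 3 * (fcellsA κ Φ t p D (KS.gT mk gx κ Φ t p D) f).r i := by
  obtain ⟨h0, h1⟩ := KS.cells_geTA' κ Φ t p D mk gx f hN hκ
  have hR := (KS.RA'_eq κ Φ t p D mk).2.1
  have hr := (fcellsA_K κ Φ t p D (KS.gT mk gx κ Φ t p D) f).2.2 i
  have hK := (Neg.forty_le_K κ).1
  have hs : KS.RA' κ Φ t p D mk + 3 ≤ (fcellsA κ Φ t p D (KS.gT mk gx κ Φ t p D) f).s i := by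
    obtain rfl | rfl : i = 0 ∨ i = 1 := by fin_cases i <;> simp
    · have : ((KS.RA' κ Φ t p D mk : ℕ) : ℤ) + 3 ≤ (((fcellsA κ Φ t p D (KS.gT mk gx κ Φ t p D) f).s 0 : ℕ) : ℤ) := by linarith
      exact_mod_cast this
    · have : ((KS.RA' κ Φ t p D mk : ℕ) : ℤ) + 3 ≤ (((fcellsA κ Φ t p D (KS.gT mk gx κ Φ t p D) f).s 1 : ℕ) : ℤ) := by linarith
      exact_mod_cast this
  constructor
  · omega
  · rw [hr]; nlinarith

/-- **The face count unit** `nFc I := c_I·|A|·|lv_I(bOf I)|` at the (ζ′) record: nonnegative and `D_A ≤ 3·nFc I` (hp-8's `hnC/hU3`; from `11·D_A < 13·c_I·L_I ≤ 26·A·rdK_I`).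
[folklore] -/
theorem nFc_RA (κ : Consts) {V : Type} [DecidableEq V] [Countable V] {G : SimpleGraph V} [G.LocallyFinite] (Φ : PlanarSkeletonFrm G) (t : V) (p : unitInterval) (D : Skelφ.StepI.DataNS V) (f : ℕ) (mk : ℕ) (gx : Neg.FSlot) (hN : EqNumL κ Φ t p D (KS.gT mk gx κ Φ t p D) f) (hκ : (hL κ Φ t p D (KS.gT mk gx κ Φ t p D) f).natAbs ≤ 10 * nL κ Φ t p D (KS.gT mk gx κ Φ t p D) f)
    (I : Fin 2) :
    0 ≤ (prFA κ Φ t p D (KS.gT mk gx κ Φ t p D) f).cOf I * |(prFA κ Φ t p D (KS.gT mk gx κ Φ t p D) f).A| *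
        |(prFA κ Φ t p D (KS.gT mk gx κ Φ t p D) f).lvGen I ((prFA κ Φ t p D (KS.gT mk gx κ Φ t p D) f).bOf I)| ∧
      (prFA κ Φ t p D (KS.gT mk gx κ Φ t p D) f).D ≤ 3 * ((prFA κ Φ t p D (KS.gT mk gx κ Φ t p D) f).cOf I * |(prFA κ Φ t p D (KS.gT mk gx κ Φ t p D) f).A| *
        |(prFA κ Φ t p D (KS.gT mk gx κ Φ t p D) f).lvGen I ((prFA κ Φ t p D (KS.gT mk gx κ Φ t p D) f).bOf I)|) := by
  set pr := prFA κ Φ t p D (KS.gT mk gx κ Φ t p D) f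
  have hs := eleven_le_s_TA κ Φ t p D f mk gx hN hκ I
  have h1 := cL_lowerA κ Φ t p D (KS.gT mk gx κ Φ t p D) f hN I hs
  have h2 := rdK_lowerA κ Φ t p D (KS.gT mk gx κ Φ t p D) f I
  have hA : pr.A = Aof κ := (prFA_fields κ Φ t p D (KS.gT mk gx κ Φ t p D) f).1
  have hA0 : 0 < Aof κ := (Aof_pos κ).1
  have hc : 0 ≤ pr.cOf I := (pr.cOf_pos (prFA_c_pos κ Φ t p D _ f).1 (prFA_c_pos κ Φ t p D _ f).2 I).le
  have e : pr.cOf I * |pr.A| * |pr.lvGen I (pr.bOf I)| = Aof κ * pr.rdK I (pr.bOf I) := by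
    unfold Skelφ.FinePrm.rdK; rw [hA, abs_of_pos hA0]; ring
  rw [e]
  have hK0 : 0 ≤ pr.rdK I (pr.bOf I) := by unfold Skelφ.FinePrm.rdK; exact mul_nonneg hc (abs_nonneg _)
  constructor
  · exact mul_nonneg hA0.le hK0
  · nlinarith

end Rooms

section Frame

/-- `0 < D_A` at the (ζ′) record under the numeric long clause. [folklore] -/
theorem prFA_D_pos (κ : Consts) {V : Type} [DecidableEq V] [Countable V] {G : SimpleGraph V} [G.LocallyFinite] (Φ : PlanarSkeletonFrm G) (t : V) (p : unitInterval) (D : Skelφ.StepI.DataNS V) (g : ℕ) (f : ℕ) (hN : EqNumL κ Φ t p D g f) : 0 < (prFA κ Φ t p D g f).D := by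
  obtain ⟨hn1, hℓ1⟩ := one_le_of_eqNumL κ Φ t p D g f hN
  rw [(prFA_fields κ Φ t p D g f).2.2.2.2.2.2.2]; exact Skelφ.NegPrm.DofA_pos (Aof_pos κ).2 hn1 hℓ1 _ _

/-- `0 ≤ awF₂ (prFA) fcellsA du` (the ceiling of a nonnegative numerator by `Mabs > 0`). [folklore] -/
theorem awF₂_nonneg_A (κ : Consts) {V : Type} [DecidableEq V] [Countable V] {G : SimpleGraph V} [G.LocallyFinite] (Φ : PlanarSkeletonFrm G) (t : V) (p : unitInterval) (D : Skelφ.StepI.DataNS V) (g : ℕ) (f : ℕ) (hN : EqNumL κ Φ t p D g f) (du : MDir) : 0 ≤ (prFA κ Φ t p D g f).awF₂ (fcellsA κ Φ t p D g f) du := by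
  set pr := prFA κ Φ t p D g f
  set P := fcellsA κ Φ t p D g f
  obtain ⟨hc₀, hc₁⟩ := prFA_c_pos κ Φ t p D g f
  have hDd := prFA_D κ Φ t p D g f
  have hDpos := prFA_D_pos κ Φ t p D g f hN
  have hM := pr.Mabs_pos hc₀ hc₁ hDd hDpos
  have hfe : ∀ i : Fin 2, 0 ≤ P.faceExt du i := fun i => by unfold PCells2.faceExt; split_ifs <;> positivity
  have hrd : ∀ I b, 0 ≤ pr.rdK I b := fun I b => by
    unfold Skelφ.FinePrm.rdK; exact mul_nonneg (pr.cOf_pos hc₀ hc₁ I).le (abs_nonneg _)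
  unfold Skelφ.FinePrm.awF₂ Skelφ.FinePrm.awNum
  apply Int.ediv_nonneg _ hM.le
  have h1 := hrd 1 (pr.bOf du.1); have h0 := hrd 0 (pr.bOf du.1); have e0 := hfe 0; have e1 := hfe 1
  have : 0 ≤ (pr.rdK 1 (pr.bOf du.1) * (P.faceExt du 0 + 1) + pr.rdK 0 (pr.bOf du.1) * (P.faceExt du 1 + 1)) * pr.D := by positivity
  linarith

/-- **`hroomF` at the (ζ′) record** with `aw du := (awF₂ du).toNat`, `kF := kFF₂ Rlev` (FaceSlots2 `hroomF_kFF₂`). [cite: KozmaNitzan2024, §4 Lemma 12 (pp. 23–25)] -/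
theorem hroomF_RA (κ : Consts) {V : Type} [DecidableEq V] [Countable V] {G : SimpleGraph V} [G.LocallyFinite] (Φ : PlanarSkeletonFrm G) (t : V) (p : unitInterval) (D : Skelφ.StepI.DataNS V) (g : ℕ) (f : ℕ) (hN : EqNumL κ Φ t p D g f) (Rlev : ℕ) (du : MDir) :
    (prFA κ Φ t p D g f).Mabs * (((((prFA κ Φ t p D g f).awF₂ (fcellsA κ Φ t p D g f) du).toNat : ℕ) : ℤ) + (Rlev : ℤ) + 1) +
        (prFA κ Φ t p D g f).rdN du.1 ((prFA κ Φ t p D g f).bOf du.1) * ((Rlev : ℤ) + 2) * (prFA κ Φ t p D g f).D ≤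
      (prFA κ Φ t p D g f).rdK du.1 ((prFA κ Φ t p D g f).bOf du.1) * (prFA κ Φ t p D g f).kFF₂ (fcellsA κ Φ t p D g f) Rlev du.1 * (prFA κ Φ t p D g f).D := by
  obtain ⟨hc₀, hc₁⟩ := prFA_c_pos κ Φ t p D g f
  rw [Int.toNat_of_nonneg (awF₂_nonneg_A κ Φ t p D g f hN du)]
  exact (prFA κ Φ t p D g f).hroomF_kFF₂ hc₀ hc₁ (prFA_D κ Φ t p D g f) (prFA_D_pos κ Φ t p D g f hN) (fcellsA κ Φ t p D g f) Rlev du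

/-- **`haw` at the (ζ′) record** with `aw du := (awF₂ du).toNat` (FaceSlots2 `haw_awF₂`). [cite: KozmaNitzan2024, §4 Lemma 12 (pp. 23–25)] -/
theorem haw_RA (κ : Consts) {V : Type} [DecidableEq V] [Countable V] {G : SimpleGraph V} [G.LocallyFinite] (Φ : PlanarSkeletonFrm G) (t : V) (p : unitInterval) (D : Skelφ.StepI.DataNS V) (g : ℕ) (f : ℕ) (hN : EqNumL κ Φ t p D g f) (du : MDir) :
    ((prFA κ Φ t p D g f).rdK 1 ((prFA κ Φ t p D g f).bOf du.1) * ((fcellsA κ Φ t p D g f).faceExt du 0 + 1) +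
          (prFA κ Φ t p D g f).rdK 0 ((prFA κ Φ t p D g f).bOf du.1) * ((fcellsA κ Φ t p D g f).faceExt du 1 + 1)) * (prFA κ Φ t p D g f).D ≤
      (prFA κ Φ t p D g f).Mabs * (((((prFA κ Φ t p D g f).awF₂ (fcellsA κ Φ t p D g f) du).toNat : ℕ) : ℤ) + 1) := by
  obtain ⟨hc₀, hc₁⟩ := prFA_c_pos κ Φ t p D g f
  rw [Int.toNat_of_nonneg (awF₂_nonneg_A κ Φ t p D g f hN du)]
  exact (prFA κ Φ t p D g f).haw_awF₂ hc₀ hc₁ (prFA_D κ Φ t p D g f) (prFA_D_pos κ Φ t p D g f hN) (fcellsA κ Φ t p D g f) du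

end Frame

/-! ## §2 The face kit's counts at `κ.δ₂` and the face apron's rooms (cell-free) -/

/-! §Kit of the N1 file (`counts_face_T`, `faceApron_rooms_T`) is NOT ported: N1's apron kit and its counts `KS.counts_R` are RETIRED under (S0)/(R-35);
the face kit's counts / rooms rows are served in N2 by stmt's `NegB.KS0` block (`counts_atq_face`, `hr₀_kit0`, `hreach_kit0`, `levels_wide`; SkelFrmBChoiceNums
p347587) — hp-8 g42's (B)(iii) 're-fitted, not renamed'. -/


end NegB

end PlanarSkeletonFrm

end Summit.CriticalPhenomena.PercolationContinuityZ3.Theorems.Transplant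

end
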